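import Mathlib

/-!
# Hodge-locus census — PROPOSITION J1 bookkeeping: the three named pieces of the jump locus `{b ≥ 1}` in the c′ = 1 cells

certified instances and evidence bearing on the general Hodge conjecture; no claim.

pub-hlocus ENGINE B (seat ivhs-2), gen 33, record `pub-hlocus-ivhs-2/ENGINEB-g33.md` §4 (def-free, notation-free, computable helper of
`stmt-HodgeConjecture-16267`; companion of `HodgeLocusCensusKroneckerProfile.lean` / `HodgeLocusCensusCellsSkeleton.lean`).

Setting (record §4, on the basis of STRATA-RED of `ENGINEB-g32.md` §13d).  In the c′ = 1 cell `(2k′, d, k′-1)` the restricted part of a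
member is `(h₁,…,h_{k′}; g)`, `h_i ∈ S_{d-1}` a complete intersection in `S = K[x₁..x_{k′}]`, `g ∈ S_{d-2}`, and the census jump is
`b = dim B₂ - rank(×g : B₂ → B_d)`, `B = S/(h)`.  PROPOSITION J1 names three irreducible closed pieces of `{b ≥ 1}` with their exact
codimensions in the `(h; g)`-space:
* `Σ°` = closure of the points having a kernel vector `(q; ℓ)`, `g q = Σ ℓ_i h_i`, with `ℓ₁..ℓ_{k′}` linearly independent:
  `codim Σ° = E + 1 = C(k′+d-1, d) - k′² - C(k′+1, 2) + 1 + k′·[d = 3]`  (J1(b), given a `b = 1` witness, which the record certifies in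
  22 cells on two independent code paths);
* `TOP = {g = 0}`: `codim TOP = C(k′+d-3, d-2)` (COROLLARY TOP of g32 §13d);
* `P` = closure of `{g divides a non-zero member of ⟨h₁..h_{k′}⟩}`: `codim P = C(k′+d-2, d-1) - 2k′ + 1` (J1(c)).
J1(a): every component of `{b ≥ 1}` has codimension `≤ E + 1`; hence `{b ≥ 1}` is REDUCIBLE as soon as `min(codim TOP, codim P) ≤ E + 1`
('undercut'), and for `k′ = 3` the record proves the list `Σ°, TOP, P` complete (J1(d)).

In this file the triple `(E+1, codim TOP, codim P)` is always the SAME explicit lambda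
`fun k d => (C(k+d-1,d) - k^2 - C(k+1,2) + 1 + k·[d=3], C(k+d-3,d-2), C(k+d-2,d-1) - 2k + 1)` over `ℤ` (written out in each statement;
no definitions, no notation).

KERNEL-CHECKED HERE (integer bookkeeping only; the geometry is the paper proof of the record):
* `table_22` : the `(E+1, TOP, P)` triples of the 22 witnessed cells (record §4 TABLE) and of the two `E = -2` cubic cells, by `decide`;
* `exceptions_box` : in the box `3 ≤ k′ ≤ 9`, `3 ≤ d ≤ 9`, among the cells with `E ≥ 0` the undercut fails exactly for
  `(6,4,2), (6,5,2), (6,6,2), (10,3,4)` (record: checked by script up to `k′, d < 40`);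
* `k3_closed_forms` : for `k′ = 3`, all `d = m + 4 ≥ 4`, the lambda's entries are `C(d+2,2) - 14`, `C(d,2)`, `C(d+1,2) - 5`;
* `k3_top_iff`, `k3_P_iff`, `k3_undercut_iff` : for `k′ = 3`, all `d ≥ 4`: `TOP ≤ E+1 ↔ d ≥ 7`, `P ≤ E+1 ↔ d ≥ 8`, undercut `↔ d ≥ 7` —
  the thresholds of J1(d) (`{b ≥ 1}` irreducible for `d = 4,5,6`; two components at `d = 7`; three from `d = 8` on);
* `k2_closed_forms`, `k2_never` : for `k′ = 2`, all `d = m + 6 ≥ 6`: `E+1 = d-5 < P = d-3 < TOP = d-1`, no undercut — consistent with the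
  irreducibility of `{b ≥ 1}` in `(4,d,1)` (X41-STRATA; referee R150 S-1).
NOT kernel-checked: J1(a)–(e) themselves (dimension counts, semicontinuity, the ℚ-irreducibility certificate of the `15 × 15` determinant
of `(6,4,2)`), see the record.
-/

namespace Summit.HodgeConjecture.HodgeConjecture.HodgeLocus.Census.JumpStratum

section Tables

/-- The `(E+1, TOP, P)` triples: `k′ = 3`, `d = 3..10`; `k′ = 4`, `d = 3..8`; `k′ = 5`, `d = 3..6`; `k′ = 6`, `d = 3..5`; `(7,3), (7,4), (8,3)`
(the cells `(6,3,2)` and `(8,3,3)` have `E + 1 = -1`: generic `b = 2`, J1 not applicable). -/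
theorem table_22 :
    (([(3,3), (3,4), (3,5), (3,6), (3,7), (3,8), (3,9), (3,10), (4,3), (4,4), (4,5), (4,6), (4,7), (4,8), (5,3), (5,4), (5,5), (5,6),
       (6,3), (6,4), (6,5), (7,3), (7,4), (8,3)] : List (ℕ × ℕ)).map
      (fun kd => (fun (k d : ℕ) =>
        ((((Nat.choose (k + d - 1) d : ℕ) : ℤ) - (k : ℤ) ^ 2 - ((Nat.choose (k + 1) 2 : ℕ) : ℤ) + 1 + (if d = 3 then (k : ℤ) else 0)),
         (((Nat.choose (k + d - 3) (d - 2) : ℕ) : ℤ)),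
         (((Nat.choose (k + d - 2) (d - 1) : ℕ) : ℤ) - 2 * (k : ℤ) + 1))) kd.1 kd.2))
    = [(-1, 3, 1), (1, 6, 5), (7, 10, 10), (14, 15, 16), (22, 21, 23), (31, 28, 31), (41, 36, 40), (52, 45, 50),
       (-1, 4, 3), (10, 10, 13), (31, 20, 28), (59, 35, 49), (95, 56, 77), (140, 84, 113),
       (1, 5, 6), (31, 15, 26), (87, 35, 61), (171, 70, 117),
       (6, 6, 10), (70, 21, 45), (196, 56, 115), (15, 7, 15), (134, 28, 71), (29, 8, 21)] := by
  decide

/-- In the box `3 ≤ k′ ≤ 9`, `3 ≤ d ≤ 9`: among the cells with `E ≥ 0` (`E + 1 ≥ 1`), NO named piece undercuts `E + 1` exactly in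
`(k′, d) = (3,4), (3,5), (3,6), (5,3)`, i.e. the cells `(6,4,2), (6,5,2), (6,6,2), (10,3,4)`. -/
theorem exceptions_box : ∀ k ∈ Finset.Icc 3 9, ∀ d ∈ Finset.Icc 3 9,
    1 ≤ (((Nat.choose (k + d - 1) d : ℕ) : ℤ) - (k : ℤ) ^ 2 - ((Nat.choose (k + 1) 2 : ℕ) : ℤ) + 1 + (if d = 3 then (k : ℤ) else 0)) →
    (¬ (min (((Nat.choose (k + d - 3) (d - 2) : ℕ) : ℤ)) ((((Nat.choose (k + d - 2) (d - 1) : ℕ) : ℤ) - 2 * (k : ℤ) + 1))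
          ≤ (((Nat.choose (k + d - 1) d : ℕ) : ℤ) - (k : ℤ) ^ 2 - ((Nat.choose (k + 1) 2 : ℕ) : ℤ) + 1 + (if d = 3 then (k : ℤ) else 0)))
      ↔ ((k = 3 ∧ (d = 4 ∨ d = 5 ∨ d = 6)) ∨ (k = 5 ∧ d = 3))) := by
  decide

end Tables

section ThreePlanes
/-! ### `k′ = 3` (the cells `(6, d, 2)`), all `d = m + 4 ≥ 4` -/

/-- Closed forms for `k′ = 3`, `d = m + 4`: the lambda's entries are `E+1 = C(d+2,2) - 14`, `TOP = C(d,2)`, `P = C(d+1,2) - 5`. -/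
theorem k3_closed_forms (m : ℕ) :
    (((Nat.choose (3 + (m + 4) - 1) (m + 4) : ℕ) : ℤ) - (3 : ℤ) ^ 2 - ((Nat.choose (3 + 1) 2 : ℕ) : ℤ) + 1
        + (if m + 4 = 3 then (3 : ℤ) else 0)) = (((m + 6).choose 2 : ℕ) : ℤ) - 14 ∧
    (((Nat.choose (3 + (m + 4) - 3) (m + 4 - 2) : ℕ) : ℤ)) = (((m + 4).choose 2 : ℕ) : ℤ) ∧
    (((Nat.choose (3 + (m + 4) - 2) (m + 4 - 1) : ℕ) : ℤ) - 2 * (3 : ℤ) + 1) = (((m + 5).choose 2 : ℕ) : ℤ) - 5 := by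
  have e1 : (m + 6).choose (m + 4) = (m + 6).choose 2 := by
    rw [show m + 6 = (m + 4) + 2 by ring, Nat.choose_symm_add]
  have e2 : (m + 4).choose (m + 2) = (m + 4).choose 2 := by
    rw [show m + 4 = (m + 2) + 2 by ring, Nat.choose_symm_add]
  have e3 : (m + 5).choose (m + 3) = (m + 5).choose 2 := by
    rw [show m + 5 = (m + 3) + 2 by ring, Nat.choose_symm_add]
  have h3 : ¬ (m + 4 = 3) := by omega
  have a1 : 3 + (m + 4) - 1 = m + 6 := by omega
  have a2 : 3 + (m + 4) - 3 = m + 4 := by omega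
  have a3 : m + 4 - 2 = m + 2 := by omega
  have a4 : 3 + (m + 4) - 2 = m + 5 := by omega
  have a5 : m + 4 - 1 = m + 3 := by omega
  have c4 : Nat.choose (3 + 1) 2 = 6 := by decide
  refine ⟨?_, ?_, ?_⟩
  · simp only [a1, e1, h3, if_false, c4]
    push_cast
    ring
  · simp only [a2, a3, e2]
  · simp only [a4, a5, e3]
    push_cast
    ring

/-- J1(d) threshold: for `k′ = 3`, `d = m + 4`: `TOP = C(d,2)` undercuts `E + 1 = C(d+2,2) - 14` iff `d ≥ 7`. -/
theorem k3_top_iff (m : ℕ) : (((m + 4).choose 2 : ℕ) : ℤ) ≤ (((m + 6).choose 2 : ℕ) : ℤ) - 14 ↔ 7 ≤ m + 4 := by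
  have p1 : (m + 5).choose 2 = (m + 4) + (m + 4).choose 2 := by
    simpa [Nat.choose_one_right] using Nat.choose_succ_succ' (m + 4) 1
  have p2 : (m + 6).choose 2 = (m + 5) + (m + 5).choose 2 := by
    simpa [Nat.choose_one_right] using Nat.choose_succ_succ' (m + 5) 1
  rw [p2, p1]
  push_cast
  omega

/-- J1(d) threshold: for `k′ = 3`, `d = m + 4`: `P = C(d+1,2) - 5` undercuts `E + 1 = C(d+2,2) - 14` iff `d ≥ 8`. -/
theorem k3_P_iff (m : ℕ) : (((m + 5).choose 2 : ℕ) : ℤ) - 5 ≤ (((m + 6).choose 2 : ℕ) : ℤ) - 14 ↔ 8 ≤ m + 4 := by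
  have p2 : (m + 6).choose 2 = (m + 5) + (m + 5).choose 2 := by
    simpa [Nat.choose_one_right] using Nat.choose_succ_succ' (m + 5) 1
  rw [p2]
  push_cast
  omega

/-- Hence for `k′ = 3`: no undercut for `d = 4, 5, 6`, undercut from `d = 7` on (J1(d): `{b ≥ 1}` irreducible iff `d ≤ 6`). -/
theorem k3_undercut_iff (m : ℕ) :
    min ((((m + 4).choose 2 : ℕ) : ℤ)) ((((m + 5).choose 2 : ℕ) : ℤ) - 5) ≤ (((m + 6).choose 2 : ℕ) : ℤ) - 14 ↔ 7 ≤ m + 4 := by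
  have ht := k3_top_iff m
  have hp := k3_P_iff m
  rw [min_le_iff]
  constructor
  · rintro (h | h)
    · exact ht.mp h
    · have := hp.mp h; omega
  · intro h; exact Or.inl (ht.mpr h)

end ThreePlanes

section TwoPlanes
/-! ### `k′ = 2` (the cells `(4, d, 1)` of X41-STRATA), all `d = m + 6 ≥ 6` -/

/-- Closed forms for `k′ = 2`, `d = m + 6`: the lambda's entries are `E + 1 = d - 5`, `TOP = d - 1`, `P = d - 3`. -/
theorem k2_closed_forms (m : ℕ) :
    (((Nat.choose (2 + (m + 6) - 1) (m + 6) : ℕ) : ℤ) - (2 : ℤ) ^ 2 - ((Nat.choose (2 + 1) 2 : ℕ) : ℤ) + 1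
        + (if m + 6 = 3 then (2 : ℤ) else 0)) = (m : ℤ) + 1 ∧
    (((Nat.choose (2 + (m + 6) - 3) (m + 6 - 2) : ℕ) : ℤ)) = (m : ℤ) + 5 ∧
    (((Nat.choose (2 + (m + 6) - 2) (m + 6 - 1) : ℕ) : ℤ) - 2 * (2 : ℤ) + 1) = (m : ℤ) + 3 := by
  have e1 : (m + 7).choose (m + 6) = m + 7 := by
    rw [show m + 7 = (m + 6) + 1 by ring, Nat.choose_symm_add, Nat.choose_one_right]
  have e2 : (m + 5).choose (m + 4) = m + 5 := by
    rw [show m + 5 = (m + 4) + 1 by ring, Nat.choose_symm_add, Nat.choose_one_right]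
  have e3 : (m + 6).choose (m + 5) = m + 6 := by
    rw [show m + 6 = (m + 5) + 1 by ring, Nat.choose_symm_add, Nat.choose_one_right]
  have h3 : ¬ (m + 6 = 3) := by omega
  have a1 : 2 + (m + 6) - 1 = m + 7 := by omega
  have a2 : 2 + (m + 6) - 3 = m + 5 := by omega
  have a3 : m + 6 - 2 = m + 4 := by omega
  have a4 : 2 + (m + 6) - 2 = m + 6 := by omega
  have a5 : m + 6 - 1 = m + 5 := by omega
  have c3 : Nat.choose (2 + 1) 2 = 3 := by decide
  refine ⟨?_, ?_, ?_⟩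
  · simp only [a1, e1, h3, if_false, c3]
    push_cast
    ring
  · simp only [a2, a3, e2]
    push_cast
    ring
  · simp only [a4, a5, e3]
    push_cast
    ring

/-- `k′ = 2`, `d = m + 6 ≥ 6`: `E + 1 < P < TOP`, so neither named piece undercuts (X41: the flag `{b ≥ 1} ⊃ cl{b = 2} ⊃ {b = 3}` has
codimensions `d-5 < d-3 < d-1`, and `{b ≥ 1}` is irreducible — R150 S-1). -/
theorem k2_never (m : ℕ) :
    (m : ℤ) + 1 < (m : ℤ) + 3 ∧ (m : ℤ) + 3 < (m : ℤ) + 5 ∧ ¬ (min ((m : ℤ) + 5) ((m : ℤ) + 3) ≤ (m : ℤ) + 1) := by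
  refine ⟨by omega, by omega, ?_⟩
  rw [min_le_iff]; omega

end TwoPlanes

end Summit.HodgeConjecture.HodgeConjecture.HodgeLocus.Census.JumpStratum
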